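import Literature.NumberTheory.EllipticCurves.IwasawaModuleFinitePadicIntProofs
import Literature.NumberTheory.EllipticCurves.IwasawaAlgebraDivisibilityProofs
import Literature.NumberTheory.EllipticCurves.IwasawaAlgebraCharIdealProofs
import Literature.NumberTheory.EllipticCurves.Kato2004.EulerSystemBoundFineSelmerTwo
import Summits.BirchSwinnertonDyer.BirchSwinnertonDyer.Theorems.ThetaPartnerAtTwoSignedTransportAtTwoSelmerPontryagin
import Summits.BirchSwinnertonDyer.BirchSwinnertonDyer.Theorems.ThetaPartnerAtTwoSignedTransportAtTwoResidualFiniteness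
import Summits.BirchSwinnertonDyer.BirchSwinnertonDyer.Theorems.ThetaPartnerAtTwoSignedKatoUpToAtTwoFineRestriction
import HarnessLib

/-!
# Seed crux `SignedMuSeedAtTwoPlus` (stmt-BirchSwinnertonDyer-21438) / Kμ⁺ `SignedMuVanishingAtTwoPlus` (stmt-20689):
# the μ-ROAD — «a Coleman–Poitou–Tate package whose zeta value is NOT divisible by `p`, plus (F)
# `Sel₀(K_∞, E[p^∞])[p]` finite, give `X^ε(E/K_∞)` torsion with `μ^ε = 0`, i.e. `Sel^ε(E/K_∞)[p]` finite»
# (step (Z4) of the plus-local half; route-independent; any number field, prime, sign)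

Cell `bsd-wall`, width seat `bsd-wall-rtt-p4-w2` g8 on crux Kμ⁺ (line `birth` v4.9: Kμ⁺ ⟺ item 21438 modulo Abbes–Ullmo)
and on the registered line `kolyvagin_char_two` / `pt_trivial_half` of the seed crux 21438, whose shared stub S1
`stub_flatPlusLocalHalfAtTwo` («FLAT ⇒ plus-local half») decomposes (card `Cruxes/SignedMuSeedAtTwoPlus/Lines/pt-trivial-half.md`)
into (Z1) exactness `Sel⁺/Sel₀ ↪ H¹_{/+}(ℚ_{2,∞})`, (Z2) integrality of Kato's class at `2`, (Z3) the μ-exact explicit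
reciprocity law `Col⁺(loc₂ z) = ϖ·L♭` at `2`, and (Z4) «reciprocity ⇒ `μ(ker(X⁺ ↠ X₀)) ≤ μ(ξ)` for ANY integral class `s` with
`Col⁺(loc s) = ξ`». THIS FILE IS (Z4), proved as MODULE ALGEBRA, route-independent (no `Theses` import), for every number
field `K`, prime `p`, `ℤ_p`-extension `κ` with topological generator `γ` and sign `ε`. HONEST FRAMING: THEOREMS ONLY — no
definition, no named fact, no instance, no `sorry`; every arithmetic input ((Z1)–(Z3): the local module `P = Col(H¹_Iw)`, the
Poitou–Tate map `j`, exactness, the zeta value `ξ = Col(loc s)` and its non-divisibility by `p`) is a DISPLAYED HYPOTHESIS —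
the «μ-package»; nothing about any curve is asserted; closes no item; BSD is NOT proved by any of this.

## The point (why the μ-road is cheaper than the length road of K3)

Route `ThetaPartnerAtTwo`'s crux K3 consumes a `2`-adic Coleman–Poitou–Tate package through LENGTHS AT HEIGHT-ONE PRIMES
`𝔭 ∌ 2` (`SignedKatoOffTwo.fourTerm_lengthAt_le`, `…OffTwoRoad` / `…OffTwoPackage` / `…OffTwoOfPub`), because there Kato's
Euler-system bound (Thm. 13.4 (2)) is needed for `X₀` and is printed only off `p`. AT the prime `𝔭 = (p)` — the μ-invariant —
the fine side is NOT asked of Kato's bound but of (F) (class numbers, or the blind-spot Kolyvagin argument S2 + S3 of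
`kolyvagin_char_two`), and then the local side needs far less than K3's package: NO injectivity of `Col`, NO `𝐇¹_Γ`, NO
`s ≠ 0`, NO surjectivity of `k`, only
* COVER `ker k ≤ range j` (Kobayashi (7.17): `P → X^ε → X₀` exact at `X^ε`; at `p = 2` exact cover needs `Δ < 0`, cf.
  `SignedKatoOffTwo.FineSandwich`: the archimedean defect is `2`-torsion and vanishes for negative discriminant),
* COMPLEX at one element: `j ξ = 0` for ONE `ξ ∈ P` (global reciprocity for the integral class `s`, `ξ = Col(loc s)`),
* the μ-clause `p ∤ ξ` (= μ-exact ERL + FLAT: `μ(Col⁺(loc _{c,d}z)) = μ((c² − σ_c)(d² − dσ_d)) + v_p(ϖ) + μ(L♭) = 0`; the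
  Euler factor has `μ = 0` for every odd `c, d ≠ ±1`, so NO `(c,d)`-division — hence no `SL₂(ℤ_p)`-image — is needed at `𝔭 = (p)`).
§1 proves the one inequality behind this (any commutative ring, any prime): `ℓ_𝔭(X) ≤ ℓ_𝔭(Y)`.

## What is proved (`Λ = IwasawaAlgebra p = ℤ_p⟦T⟧`, `𝔭_p = (p) = augIdealP p`)

* §1 `lengthAt_le_of_cover_of_smul_ker` — for `R`-linear `j : P → X`, `k : X → Y` with `ker k ≤ range j` and a scalar
  `a ∉ 𝔭` with `j (a • x) = 0` for all `x`: `ℓ_𝔭(X) ≤ ℓ_𝔭(Y)` (`ℓ_𝔭(X) = ℓ_𝔭(ker k) + ℓ_𝔭(X/ker k)`, `X/ker k ↪ Y`,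
  `ker k ↪ range j ≅ P/ker j` killed by `a`). Ideal form `lengthAt_le_of_cover_of_mem` (`P ≤ R`, `ξ ∈ P`, `j ξ = 0`, `ξ ∉ 𝔭`).
* §2 at `𝔭_p`: `lengthAt_augIdealP_eq_zero_of_muPackage` (`+ ℓ_{(p)}(Y) = 0 ⇒ ℓ_{(p)}(X) = 0`);
  `isTorsion_and_muInvariant_eq_zero_of_lengthAt_eq_zero` (f.g. `X` with `ℓ_{(p)}(X) = 0` is torsion with `μ = 0`);
  `lengthAt_augIdealP_fineDual_eq_zero_of_finite_pTorsion` ((F) `Sel₀(K_∞)[p]` finite ⇒ `ℓ_{(p)}(X₀) = 0` for EVERY pinned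
  fine dual datum at a topological generator — doors `FineSelmerDualData.module_finite_of_finite_pTorsion` /
  `finite_quotient_augIdealP_of_finite_pTorsion` / `IwasawaModuleFinitePadicInt`).
* §3 THE μ-ROAD on the pinned duals: `isTorsion_and_mu_eq_zero_of_muPackage` — for `D : SignedSelmerDualData W κ γ ε`
  (f.g.), `Y : W.FineSelmerDualData κ γ`, a μ-package `(P, j, k, ξ)` and (F): `X^ε` is `Λ`-torsion with `μ^ε = 0`;
  `finite_signedSelmer_pTorsion_of_muPackage` — hence `Sel^ε(E/K_∞)[p]` finite (Pontryagin door
  `SignedTransportAtTwo.finite_quotient_augIdealP_iff_finite_pTorsion`), and `forall_isTorsion_and_mu_eq_zero_of_muPackage`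
  — for EVERY finitely generated datum `D'` at `(κ, γ)`.
* §4 the same in the BINDER SHAPE of route TP2's (7.20)-package (`signedKatoDivisibilityUpToAtTwo_of_poitouTatePackageTwo_of_pub`:
  `∃ I Y P col j k s, Exact col j ∧ Exact j k ∧ IsEulerSystemClassTwo s ∧ …`) at `p = 2`, with the length clause at `𝔭 ∌ 2`
  REPLACED by the μ-clause `¬ C 2 ∣ col s`: `finite_signedSelmer_twoTorsion_of_poitouTateMuPackageTwo` — ONE displayed package
  then serves K3 off `2` and the plus-local half at `2`.

References: [Kobayashi2003] S. Kobayashi, Invent. Math. 152 (2003), (7.17)–(7.21), Thm. 7.3 and proof of Thm. 7.4 (pp. 12–13),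
Thm. 6.3 (p. 11); [KuriharaPollack2007] proof of Prop. 3.4 (the odd-`p` sequence `0 → 𝐇¹_loc/𝐇¹_glob → Sel^∨ → Sel₀^∨ → 0`);
[GreenbergVatsal2000] Prop. (2.8) (`μ = 0` ⟺ `Sel[p]` finite); [GreenbergLNM1716] §1 p. 60; [Washington1997] §13.2;
[Kato2004Asterisque] Thm. 12.5 (p. 222), §13.1, Ex. 13.3 (pp. 224–225), Prop. 13.7 (p. 227); [NeukirchSchmidtWingberg2008] Ch. V §1 (5.1.4).
-/

set_option autoImplicit false
-- the Theorems namespace of this sub repeats the summit name by design (D-0017 nested layout)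
set_option linter.dupNamespace false

noncomputable section

open scoped Classical NumberField

open WeierstrassCurve Field IsDedekindDomain
  Literature.NumberTheory.GaloisRepresentations
  Literature.NumberTheory.EllipticCurves Literature.NumberTheory.EllipticCurves.Module
  Literature.NumberTheory.EllipticCurves.IwasawaAlgebra Literature.NumberTheory.EllipticCurves.Kobayashi2003
  Literature.NumberTheory.EllipticCurves.Kato2004 Literature.NumberTheory.EllipticCurves.Kato2004.EulerSystemValues
  ZpExtension

namespace Summit.BirchSwinnertonDyer.BirchSwinnertonDyer.Theorems

namespace SignedMuAtTwo.PlusLocalMuRoad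

universe u

/-! ## §1 The one inequality (any commutative ring, any prime) -/

section AnyRing

variable {R : Type*} [CommRing R] {P X Y : Type*} [AddCommGroup P] [_root_.Module R P]
  [AddCommGroup X] [_root_.Module R X] [AddCommGroup Y] [_root_.Module R Y]

/-- **Cover + one killed generator ⇒ `ℓ_𝔭(X) ≤ ℓ_𝔭(Y)`.** For `R`-linear `j : P → X`, `k : X → Y` with `ker k ≤ range j`
(COVER) and a scalar `a ∉ 𝔭` such that `j (a • x) = 0` for every `x : P` (so `range j ≅ P/ker j` is killed by `a`, hence
`(range j)_𝔭 = 0`): `ℓ_𝔭(X) = ℓ_𝔭(ker k) + ℓ_𝔭(X/ker k) ≤ ℓ_𝔭(range j) + ℓ_𝔭(Y) = ℓ_𝔭(Y)`. The `𝔭 = (p)` reading of the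
four-term inequality of the Coleman road (Kobayashi, proof of Thm. 7.4) — with no injectivity, no `𝐇¹`, no non-vanishing.
[cite: Kobayashi2003, (7.21) and proof of Thm. 7.4 (p. 13)] [cite: NeukirchSchmidtWingberg2008, Ch. V §1, (5.1.4) Remark 1] -/
theorem lengthAt_le_of_cover_of_smul_ker (j : P →ₗ[R] X) (k : X →ₗ[R] Y) (𝔭 : PrimeSpectrum R) {a : R}
    (ha : a ∉ 𝔭.asIdeal) (hja : ∀ x : P, j (a • x) = 0) (hcover : LinearMap.ker k ≤ LinearMap.range j) :
    lengthAt R X 𝔭 ≤ lengthAt R Y 𝔭 := by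
  -- `ℓ(X) = ℓ(ker k) + ℓ(X / ker k)`
  have h1 : lengthAt R X 𝔭 = lengthAt R (LinearMap.ker k) 𝔭 + lengthAt R (X ⧸ LinearMap.ker k) 𝔭 :=
    lengthAt_eq_add_quotient (LinearMap.ker k) 𝔭
  -- `X / ker k ≅ range k ≤ Y`
  have h2 : lengthAt R (X ⧸ LinearMap.ker k) 𝔭 ≤ lengthAt R Y 𝔭 := by
    rw [lengthAt_eq_of_linearEquiv k.quotKerEquivRange 𝔭]
    exact lengthAt_submodule_le (LinearMap.range k) 𝔭
  -- `ker k ≤ range j ≅ P / ker j`, killed by `a ∉ 𝔭`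
  have h3 : lengthAt R (LinearMap.ker k) 𝔭 ≤ lengthAt R (LinearMap.range j) 𝔭 :=
    lengthAt_le_of_injective (Submodule.inclusion hcover) (Submodule.inclusion_injective hcover) 𝔭
  have h4 : lengthAt R (LinearMap.range j) 𝔭 = 0 := by
    rw [← lengthAt_eq_of_linearEquiv j.quotKerEquivRange 𝔭]
    refine lengthAt_eq_zero_of_isTorsionBy (s := a) (fun x ↦ ?_) 𝔭 ha
    induction x using Submodule.Quotient.induction_on with
    | H y =>
      rw [← Submodule.Quotient.mk_smul, Submodule.Quotient.mk_eq_zero, LinearMap.mem_ker]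
      exact hja y
  calc lengthAt R X 𝔭 = lengthAt R (LinearMap.ker k) 𝔭 + lengthAt R (X ⧸ LinearMap.ker k) 𝔭 := h1
    _ ≤ 0 + lengthAt R Y 𝔭 := add_le_add (h3.trans h4.le) h2
    _ = lengthAt R Y 𝔭 := zero_add _

/-- **Ideal form.** For a submodule `P ≤ R` (the image of a Coleman functional), `R`-linear `j : P → X`, `k : X → Y` with
`ker k ≤ range j`, and ONE element `ξ ∈ P` with `j ξ = 0` and `ξ ∉ 𝔭`: `ℓ_𝔭(X) ≤ ℓ_𝔭(Y)` (since `ξ • x = x • ξ` in `P`,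
`j` kills `ξ • P`). [cite: Kobayashi2003, (7.21) and proof of Thm. 7.4 (p. 13)] -/
theorem lengthAt_le_of_cover_of_mem (P : Submodule R R) (j : P →ₗ[R] X) (k : X →ₗ[R] Y) (𝔭 : PrimeSpectrum R)
    {ξ : R} (hξP : ξ ∈ P) (hξ : ξ ∉ 𝔭.asIdeal) (hjξ : j ⟨ξ, hξP⟩ = 0)
    (hcover : LinearMap.ker k ≤ LinearMap.range j) :
    lengthAt R X 𝔭 ≤ lengthAt R Y 𝔭 := by
  refine lengthAt_le_of_cover_of_smul_ker j k 𝔭 hξ (fun x ↦ ?_) hcover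
  have hx : ξ • x = (x : R) • (⟨ξ, hξP⟩ : P) :=
    Subtype.ext (by simp only [SetLike.val_smul, smul_eq_mul, mul_comm])
  rw [hx, map_smul, hjξ, smul_zero]

end AnyRing

/-! ## §2 At the prime `(p)` of `Λ = ℤ_p⟦T⟧` -/

section Lambda

variable {p : ℕ} [Fact p.Prime]

/-- `ξ ∉ (p)` iff the constant power series `p` does not divide `ξ` in `Λ`. [cite: Washington1997, §13.1] -/
theorem not_mem_augIdealP_iff {ξ : IwasawaAlgebra p} :
    ξ ∉ augIdealP p ↔ ¬ PowerSeries.C (p : ℤ_[p]) ∣ ξ := by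
  rw [augIdealP, Ideal.mem_span_singleton]

variable {X Y : Type*} [AddCommGroup X] [_root_.Module (IwasawaAlgebra p) X]
  [AddCommGroup Y] [_root_.Module (IwasawaAlgebra p) Y]

/-- **μ-package ⇒ `ℓ_{(p)}(X) ≤ ℓ_{(p)}(Y)`**: `P ≤ Λ`, `j : P → X`, `k : X → Y` `Λ`-linear with `ker k ≤ range j`,
`ξ ∈ P` with `j ξ = 0` and `p ∤ ξ`. [cite: Kobayashi2003, (7.21) and proof of Thm. 7.4 (p. 13)] [cite: Washington1997, §13.2] -/
theorem lengthAt_augIdealP_le_of_muPackage (P : Submodule (IwasawaAlgebra p) (IwasawaAlgebra p))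
    (j : P →ₗ[IwasawaAlgebra p] X) (k : X →ₗ[IwasawaAlgebra p] Y) {ξ : IwasawaAlgebra p} (hξP : ξ ∈ P)
    (hξ : ¬ PowerSeries.C (p : ℤ_[p]) ∣ ξ) (hjξ : j ⟨ξ, hξP⟩ = 0)
    (hcover : LinearMap.ker k ≤ LinearMap.range j) (𝔭 : PrimeSpectrum (IwasawaAlgebra p))
    (h𝔭 : 𝔭.asIdeal = augIdealP p) :
    lengthAt (IwasawaAlgebra p) X 𝔭 ≤ lengthAt (IwasawaAlgebra p) Y 𝔭 :=
  lengthAt_le_of_cover_of_mem P j k 𝔭 hξP (by rw [h𝔭]; exact not_mem_augIdealP_iff.mpr hξ) hjξ hcover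

/-- **μ-package + `ℓ_{(p)}(Y) = 0` ⇒ `ℓ_{(p)}(X) = 0`.** [cite: Kobayashi2003, (7.21) and proof of Thm. 7.4 (p. 13)] -/
theorem lengthAt_augIdealP_eq_zero_of_muPackage (P : Submodule (IwasawaAlgebra p) (IwasawaAlgebra p))
    (j : P →ₗ[IwasawaAlgebra p] X) (k : X →ₗ[IwasawaAlgebra p] Y) {ξ : IwasawaAlgebra p} (hξP : ξ ∈ P)
    (hξ : ¬ PowerSeries.C (p : ℤ_[p]) ∣ ξ) (hjξ : j ⟨ξ, hξP⟩ = 0)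
    (hcover : LinearMap.ker k ≤ LinearMap.range j) (𝔭 : PrimeSpectrum (IwasawaAlgebra p))
    (h𝔭 : 𝔭.asIdeal = augIdealP p) (hY : lengthAt (IwasawaAlgebra p) Y 𝔭 = 0) :
    lengthAt (IwasawaAlgebra p) X 𝔭 = 0 :=
  le_antisymm (hY ▸ lengthAt_augIdealP_le_of_muPackage P j k hξP hξ hjξ hcover 𝔭 h𝔭) zero_le

/-- **A finitely generated `Λ`-module with `ℓ_{(p)}(X) = 0` is `Λ`-torsion with `μ(X) = 0`**: `X_{(p)} = 0` gives an
annihilator element `g ∉ (p)` (so `g ≠ 0`, torsion), and `μ(X) = ℓ_{(p)}(X) = 0` by definition.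
[cite: Washington1997, §13.2] [cite: GreenbergVatsal2000, §2 Prop. (2.8)] -/
theorem isTorsion_and_muInvariant_eq_zero_of_lengthAt_eq_zero [Module.Finite (IwasawaAlgebra p) X]
    (𝔭 : PrimeSpectrum (IwasawaAlgebra p)) (h𝔭 : 𝔭.asIdeal = augIdealP p)
    (h : lengthAt (IwasawaAlgebra p) X 𝔭 = 0) :
    Module.IsTorsion (IwasawaAlgebra p) X ∧ muInvariant p X = 0 := by
  refine ⟨?_, by rw [muInvariant_eq_toNat_lengthAt p X 𝔭 h𝔭, h]; rfl⟩
  have h' := h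
  rw [lengthAt, Module.length_eq_zero_iff, ← Module.notMem_support_iff, Module.mem_support_iff_of_finite,
    SetLike.not_le_iff_exists] at h'
  obtain ⟨g, hg, hg𝔭⟩ := h'
  rw [Module.mem_annihilator] at hg
  have hg0 : g ≠ 0 := fun h0 ↦ hg𝔭 (h0 ▸ 𝔭.asIdeal.zero_mem)
  intro x
  exact ⟨⟨g, mem_nonZeroDivisors_of_ne_zero hg0⟩, hg x⟩

end Lambda

/-! ## §2b (F) in length currency: `Sel₀(K_∞)[p]` finite ⇒ `ℓ_{(p)}(X₀) = 0` for every pinned fine dual datum -/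

section Fine

variable {K : Type u} [Field K] [NumberField K] {W : WeierstrassCurve K} {p : ℕ} [Fact p.Prime]
  {κ : ZpExtension K p} {γ : Field.absoluteGaloisGroup K}

/-- **(F) ⇒ `ℓ_{(p)}(X₀(E/K_∞)) = 0`** for EVERY pinned fine dual datum `Y` at a topological generator `γ`: `Sel₀(K_∞, E[p^∞])[p]`
finite ⇒ `X₀` finitely generated over `Λ` with `X₀/(p)X₀` finite (tree `FineSelmerDualData.module_finite_of_finite_pTorsion`,
`…finite_quotient_augIdealP_of_finite_pTorsion`) ⇒ finitely generated over `ℤ_p` (`IwasawaModuleFinitePadicInt`) ⇒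
`X₀,(p) = 0` (`lengthAt_eq_zero_of_finite`). [cite: GreenbergLNM1716, §1 p. 60 (after Conj. 1.3)] [cite: Washington1997, §13.2] -/
theorem lengthAt_augIdealP_fineDual_eq_zero_of_finite_pTorsion [W.IsElliptic] (hγ : κ.IsTopGenerator γ)
    (Y : W.FineSelmerDualData κ γ) (hF : Set.Finite {s : W.fineSelmerInfty κ | p • s = 0})
    (𝔭 : PrimeSpectrum (IwasawaAlgebra p)) (h𝔭 : 𝔭.asIdeal = augIdealP p) :
    lengthAt (IwasawaAlgebra p) Y.X 𝔭 = 0 := by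
  haveI : Module.Finite (IwasawaAlgebra p) Y.X := Y.module_finite_of_finite_pTorsion hγ hF
  have hfg := IwasawaModuleFinitePadicInt.moduleFinite_padicInt_of_finite_quotient_augIdealP p Y.X
    (Y.finite_quotient_augIdealP_of_finite_pTorsion hF)
  letI : _root_.Module ℤ_[p] Y.X := Module.compHom Y.X (algebraMap ℤ_[p] (IwasawaAlgebra p))
  haveI : IsScalarTower ℤ_[p] (IwasawaAlgebra p) Y.X := IsScalarTower.of_compHom ℤ_[p] _ Y.X
  haveI : Module.Finite ℤ_[p] Y.X := hfg
  exact lengthAt_eq_zero_of_finite p Y.X 𝔭 h𝔭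

end Fine

/-! ## §3 The μ-road on the pinned duals (any number field, prime, sign) -/

section Road

variable {K : Type u} [Field K] [NumberField K] {W : WeierstrassCurve K} {p : ℕ} [Fact p.Prime]
  {κ : ZpExtension K p} {γ : Field.absoluteGaloisGroup K} {ε : ℤˣ}

/-- **THE μ-ROAD.** Let `D` be a pinned dual datum of `Sel^ε(E/K_∞)` with `X^ε = D.X` finitely generated, `Y` a pinned fine
dual datum at the same `(κ, γ)` (`γ` a topological generator), and suppose given a **μ-package**: a submodule `P ≤ Λ`,
`Λ`-linear `j : P → X^ε` and `k : X^ε → X₀ = Y.X` with COVER `ker k ≤ range j`, and an element `ξ ∈ P` with `j ξ = 0` and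
`p ∤ ξ` — in the intended instance `P = Col^ε(H¹_Iw(K_{∞,p}, T))`, `j` the Poitou–Tate map, `k` the restriction dual to
`Sel₀ ≤ Sel^ε` (`SignedKatoOffTwo.FineRestriction`), `ξ = Col^ε(loc_p s)` for an integral Euler-system class `s` (global
reciprocity gives `j ξ = 0`; the μ-exact explicit reciprocity law + FLAT give `p ∤ ξ`). If (F) `Sel₀(K_∞, E[p^∞])[p]` is
finite, then `X^ε` is `Λ`-torsion with `μ^ε = 0`. [cite: Kobayashi2003, (7.17)–(7.21) and proof of Thm. 7.4 (pp. 12–13)]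
[cite: GreenbergVatsal2000, §2 Prop. (2.8)] [cite: Washington1997, §13.2] -/
theorem isTorsion_and_mu_eq_zero_of_muPackage [W.IsElliptic] (hγ : κ.IsTopGenerator γ)
    (D : SignedSelmerDualData W κ γ ε) [Module.Finite (IwasawaAlgebra p) D.X] (Y : W.FineSelmerDualData κ γ)
    (P : Submodule (IwasawaAlgebra p) (IwasawaAlgebra p)) (j : P →ₗ[IwasawaAlgebra p] D.X)
    (k : D.X →ₗ[IwasawaAlgebra p] Y.X) {ξ : IwasawaAlgebra p} (hξP : ξ ∈ P)
    (hξ : ¬ PowerSeries.C (p : ℤ_[p]) ∣ ξ) (hjξ : j ⟨ξ, hξP⟩ = 0) (hcover : LinearMap.ker k ≤ LinearMap.range j)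
    (hF : Set.Finite {s : W.fineSelmerInfty κ | p • s = 0}) :
    Module.IsTorsion (IwasawaAlgebra p) D.X ∧ D.mu = 0 :=
  isTorsion_and_muInvariant_eq_zero_of_lengthAt_eq_zero ⟨augIdealP p, isPrime_augIdealP_holds p⟩ rfl
    (lengthAt_augIdealP_eq_zero_of_muPackage P j k hξP hξ hjξ hcover _ rfl
      (lengthAt_augIdealP_fineDual_eq_zero_of_finite_pTorsion hγ Y hF _ rfl))

/-- **μ-road, Selmer-group currency**: under the hypotheses of `isTorsion_and_mu_eq_zero_of_muPackage`, the `p`-torsion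
`Sel^ε(E/K_∞)[p]` of Kobayashi's signed Selmer GROUP is finite (Pontryagin: `X^ε` torsion with `μ = 0` ⟺ `X^ε/(p)` finite ⟺
`Sel^ε[p]` finite, `SignedTransportAtTwo.finite_quotient_of_muInvariant_eq_zero` / `…finite_quotient_augIdealP_iff_finite_pTorsion`).
[cite: GreenbergVatsal2000, p. 3 (proof of Thm. (1.4)) and Prop. (2.8)] [cite: GreenbergLNM1716, §1 p. 60] -/
theorem finite_signedSelmer_pTorsion_of_muPackage [W.IsElliptic] (hγ : κ.IsTopGenerator γ)
    (D : SignedSelmerDualData W κ γ ε) [Module.Finite (IwasawaAlgebra p) D.X] (Y : W.FineSelmerDualData κ γ)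
    (P : Submodule (IwasawaAlgebra p) (IwasawaAlgebra p)) (j : P →ₗ[IwasawaAlgebra p] D.X)
    (k : D.X →ₗ[IwasawaAlgebra p] Y.X) {ξ : IwasawaAlgebra p} (hξP : ξ ∈ P)
    (hξ : ¬ PowerSeries.C (p : ℤ_[p]) ∣ ξ) (hjξ : j ⟨ξ, hξP⟩ = 0) (hcover : LinearMap.ker k ≤ LinearMap.range j)
    (hF : Set.Finite {s : W.fineSelmerInfty κ | p • s = 0}) :
    Set.Finite {s : signedSelmerInfty W κ ε | p • s = 0} := by
  obtain ⟨hT, hμ⟩ := isTorsion_and_mu_eq_zero_of_muPackage hγ D Y P j k hξP hξ hjξ hcover hF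
  exact (SignedTransportAtTwo.finite_quotient_augIdealP_iff_finite_pTorsion D).mp
    (SignedTransportAtTwo.finite_quotient_of_muInvariant_eq_zero hT hμ)

/-- **μ-road for EVERY datum**: a μ-package for ONE finitely generated pinned datum `D₀` of `Sel^ε(E/K_∞)` and (F) give
«torsion with `μ = 0`» for EVERY finitely generated pinned datum `D` at `(κ, γ)` (through the datum-free statement
`Sel^ε(E/K_∞)[p]` finite). [cite: GreenbergVatsal2000, p. 3 (proof of Thm. (1.4)) and Prop. (2.8)] [cite: GreenbergLNM1716, §1 p. 60] -/
theorem forall_isTorsion_and_mu_eq_zero_of_muPackage [W.IsElliptic] (hγ : κ.IsTopGenerator γ)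
    (D₀ : SignedSelmerDualData W κ γ ε) [Module.Finite (IwasawaAlgebra p) D₀.X] (Y : W.FineSelmerDualData κ γ)
    (P : Submodule (IwasawaAlgebra p) (IwasawaAlgebra p)) (j : P →ₗ[IwasawaAlgebra p] D₀.X)
    (k : D₀.X →ₗ[IwasawaAlgebra p] Y.X) {ξ : IwasawaAlgebra p} (hξP : ξ ∈ P)
    (hξ : ¬ PowerSeries.C (p : ℤ_[p]) ∣ ξ) (hjξ : j ⟨ξ, hξP⟩ = 0) (hcover : LinearMap.ker k ≤ LinearMap.range j)
    (hF : Set.Finite {s : W.fineSelmerInfty κ | p • s = 0})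
    (D : SignedSelmerDualData W κ γ ε) [Module.Finite (IwasawaAlgebra p) D.X] :
    Module.IsTorsion (IwasawaAlgebra p) D.X ∧ D.mu = 0 :=
  SignedTransportAtTwo.isTorsion_and_muInvariant_eq_zero_of_finite_quotient
    ((SignedTransportAtTwo.finite_quotient_augIdealP_iff_finite_pTorsion D).mpr
      (finite_signedSelmer_pTorsion_of_muPackage hγ D₀ Y P j k hξP hξ hjξ hcover hF))

/-- **μ-road with the PINNED restriction `k`.** Same, with `k` any `Λ`-linear map reading `Y.toDual (k x) = (D.toDual x) ∘ ι₀`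
(the restriction dual to `Sel₀ ≤ Sel^ε`, which EXISTS and is unique: `SignedKatoOffTwo.FineRestriction.exists_fineRestrict`);
the cover hypothesis then reads «every character of `Sel^ε` vanishing on `Sel₀` lies in `range j`»
(`SignedKatoOffTwo.FineRestriction.mem_ker_fineRestrict_iff`). [cite: Kobayashi2003, (7.17)–(7.21) (pp. 12–13)] -/
theorem isTorsion_and_mu_eq_zero_of_muPackage_fineRestrict [W.IsElliptic] (hγ : κ.IsTopGenerator γ)
    (D : SignedSelmerDualData W κ γ ε) [Module.Finite (IwasawaAlgebra p) D.X] (Y : W.FineSelmerDualData κ γ)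
    (P : Submodule (IwasawaAlgebra p) (IwasawaAlgebra p)) (j : P →ₗ[IwasawaAlgebra p] D.X)
    (k : D.X →ₗ[IwasawaAlgebra p] Y.X)
    (hk : ∀ (x : D.X) (s : W.fineSelmerInfty κ),
      Y.toDual (k x) s = D.toDual x (AddSubgroup.inclusion (fineSelmerInfty_le_signedSelmerInfty W κ ε) s))
    {ξ : IwasawaAlgebra p} (hξP : ξ ∈ P) (hξ : ¬ PowerSeries.C (p : ℤ_[p]) ∣ ξ) (hjξ : j ⟨ξ, hξP⟩ = 0)
    (hcover : ∀ x : D.X, (∀ s : W.fineSelmerInfty κ,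
        D.toDual x (AddSubgroup.inclusion (fineSelmerInfty_le_signedSelmerInfty W κ ε) s) = 0) →
      x ∈ LinearMap.range j)
    (hF : Set.Finite {s : W.fineSelmerInfty κ | p • s = 0}) :
    Module.IsTorsion (IwasawaAlgebra p) D.X ∧ D.mu = 0 := by
  refine isTorsion_and_mu_eq_zero_of_muPackage hγ D Y P j k hξP hξ hjξ (fun x hx ↦ hcover x ?_) hF
  exact (SignedKatoOffTwo.FineRestriction.mem_ker_fineRestrict_iff W κ D Y k hk x).mp hx

end Road

/-! ## §4 `p = 2`: the μ-road in the binder shape of route TP2's Poitou–Tate package -/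

section AtTwo

variable {W : WeierstrassCurve ℚ} [W.IsElliptic] [ContinuousSMul ℤ_[2] (W.tateModule 2)]
  [Module.Free ℤ_[2] (W.tateModule 2)] [Module.Finite ℤ_[2] (W.tateModule 2)]
  {κ : ZpExtension ℚ 2} {γ : Field.absoluteGaloisGroup ℚ}

/-- **The μ-road in TP2's binder shape (`p = 2`, sign `+`).** Suppose that for ONE finitely generated pinned datum `D₀` of
`Sel⁺(E/ℚ_∞)` there are — EXACTLY the binders of the (7.20)-package of
`SignedKatoOffTwo.signedKatoDivisibilityUpToAtTwo_of_poitouTatePackageTwo_of_pub`, the clause at `𝔭 ∌ 2` replaced by the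
μ-clause — a pinned `𝐇¹_Γ(T₂E)`-datum `I`, a fine dual datum `Y`, `P ≤ Λ`, `col : 𝐇¹ → P`, `j : P → X⁺`, `k : X⁺ → X₀` with
`𝐇¹ →col P →j X⁺ →k X₀` exact at `P` and at `X⁺` (Kobayashi (7.20)), a genuine `2`-adic Euler-system class `s`
(`Kato2004.IsEulerSystemClassTwo`; not used by the algebra, displayed for comparability) and **`2 ∤ col s`** (μ-exact ERL⁺
at `2` + FLAT). If (F) `Sel₀(ℚ_∞, E[2^∞])[2]` is finite, then EVERY finitely generated pinned datum `D` of `Sel⁺(E/ℚ_∞)` at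
`(κ, γ)` is `Λ`-torsion with `μ⁺ = 0`. ONE displayed package thus serves K3 off `2` (lengths) and the plus-local half at `2` (μ).
[cite: Kobayashi2003, (7.17)–(7.21), Thm. 7.3 and proof of Thm. 7.4 (pp. 12–13), Thm. 6.3 (p. 11)]
[cite: Kato2004Asterisque, Thm. 12.5 (p. 222) and §13.1, Ex. 13.3 (pp. 224–225)] [cite: GreenbergVatsal2000, §2 Prop. (2.8)] -/
theorem isTorsion_and_mu_eq_zero_of_poitouTateMuPackageTwo (hκ : κ.IsCyclotomic) (hγ : κ.IsTopGenerator γ)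
    (D₀ : SignedSelmerDualData W κ γ 1) [Module.Finite (IwasawaAlgebra 2) D₀.X]
    (hPT : ∃ (I : Kato2004.IwasawaH1Data W 2 κ γ) (Y : W.FineSelmerDualData κ γ)
      (P : Submodule (IwasawaAlgebra 2) (IwasawaAlgebra 2))
      (col : I.H →ₗ[IwasawaAlgebra 2] P) (j : P →ₗ[IwasawaAlgebra 2] D₀.X)
      (k : D₀.X →ₗ[IwasawaAlgebra 2] Y.X) (s : I.H),
      Function.Exact col j ∧ Function.Exact j k ∧ Kato2004.IsEulerSystemClassTwo W hκ I s ∧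
        ¬ PowerSeries.C (2 : ℤ_[2]) ∣ (P.subtype (col s)))
    (hF : Set.Finite {s : W.fineSelmerInfty κ | 2 • s = 0})
    (D : SignedSelmerDualData W κ γ 1) [Module.Finite (IwasawaAlgebra 2) D.X] :
    Module.IsTorsion (IwasawaAlgebra 2) D.X ∧ D.mu = 0 := by
  obtain ⟨I, Y, P, col, j, k, s, hcj, hjk, _hES, hμ⟩ := hPT
  refine forall_isTorsion_and_mu_eq_zero_of_muPackage hγ D₀ Y P j k (col s).2 hμ ?_ ?_ hF D
  · rw [Subtype.coe_eta]
    exact hcj.apply_apply_eq_zero s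
  · exact (hjk.linearMap_ker_eq).le

/-- **Same, Selmer-group currency**: the μ-package (TP2 binder shape, μ-clause `2 ∤ col s`) for one finitely generated pinned
datum + (F) ⟹ `Sel⁺(E/ℚ_∞)[2]` is finite — the conclusion of the landed split `SignedMuAtTwo.FineSplit.splitFiniteness`
(line `pt_trivial_half`: S1 + (F)), here WITHOUT the stub S1. [cite: Kobayashi2003, (7.17)–(7.21) (pp. 12–13)]
[cite: GreenbergVatsal2000, p. 3 (proof of Thm. (1.4)) and Prop. (2.8)] -/
theorem finite_signedSelmer_twoTorsion_of_poitouTateMuPackageTwo (hκ : κ.IsCyclotomic) (hγ : κ.IsTopGenerator γ)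
    (D₀ : SignedSelmerDualData W κ γ 1) [Module.Finite (IwasawaAlgebra 2) D₀.X]
    (hPT : ∃ (I : Kato2004.IwasawaH1Data W 2 κ γ) (Y : W.FineSelmerDualData κ γ)
      (P : Submodule (IwasawaAlgebra 2) (IwasawaAlgebra 2))
      (col : I.H →ₗ[IwasawaAlgebra 2] P) (j : P →ₗ[IwasawaAlgebra 2] D₀.X)
      (k : D₀.X →ₗ[IwasawaAlgebra 2] Y.X) (s : I.H),
      Function.Exact col j ∧ Function.Exact j k ∧ Kato2004.IsEulerSystemClassTwo W hκ I s ∧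
        ¬ PowerSeries.C (2 : ℤ_[2]) ∣ (P.subtype (col s)))
    (hF : Set.Finite {s : W.fineSelmerInfty κ | 2 • s = 0}) :
    Set.Finite {s : signedSelmerInfty W κ 1 | 2 • s = 0} := by
  obtain ⟨hT, hμ⟩ := isTorsion_and_mu_eq_zero_of_poitouTateMuPackageTwo hκ hγ D₀ hPT hF D₀
  exact (SignedTransportAtTwo.finite_quotient_augIdealP_iff_finite_pTorsion D₀).mp
    (SignedTransportAtTwo.finite_quotient_of_muInvariant_eq_zero hT hμ)

end AtTwo

end SignedMuAtTwo.PlusLocalMuRoad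

end Summit.BirchSwinnertonDyer.BirchSwinnertonDyer.Theorems

end
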